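import Mathlib
import Literature.Analysis.FluidPDE.VectorCalculus
import Summits.NavierStokesRegularity.NavierStokesRegularity.Theorems.FilamentSkeletonRssSelectionBoxRJRungZoneLemma
import Summits.NavierStokesRegularity.NavierStokesRegularity.Theorems.FilamentSkeletonRssSelectionBoxRJRungPartnerStrain
import Summits.NavierStokesRegularity.NavierStokesRegularity.Theorems.FilamentSkeletonRssSelectionBoxRJRungSelfStrain

/-!
# Route `FilamentSkeletonRss` · crux `SelectionBoxRJ` (stmt-NavierStokesRegularity-21220) — rung tools:
# the QUANTITATIVE zone lemma for clause 11 (headline of the lane-g6 package)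

Lane `ns-filament-19175-p1` (g6).  Helper file `--supports stmt-NavierStokesRegularity-21220`.  One citable statement
combining the zone lemma (`box_zone_zero_unique`, p580083), the partner strain decay (`biotSavart_axialStrain_le`,
p577644) and the self-strain bound (`self_axialStrain_le`, p579910):

* `box_zone_zero_unique_quantitative` — for a box datum (filaments `X_k`, `C¹`, `‖X_k′‖ ≤ 1`, linear growth; skeleton
  field `Σ_k c_k F_k` with core `e ≠ 0`; filament `j` `C²`, unit speed, `‖X_j″‖ ≤ κ₀`, `X_j″` `H`-Lipschitz,
  near-straight with angle `θ`, tangential speed `w` differentiable, exact tangency on an open parameter set `S`), on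
  any convex `D ⊆ S` along which filament `j` is chord-arc (constant `c`) from each of its points and every OTHER
  filament is seen at distance `≥ D_k` with linear escape (`c′|u − u₀| − A_k ≤ dist`), the smallness condition
  `Σ_{k} |c_k| B_k < ½`, `B_k = 8π(D_k + A_k)/(c′D_k³)` (`k ≠ j`), `B_j = 6θ/(c⁴δ²) + 2δ(3/c⁴)((3/2)κ₀H + H²δ)` (any
  window `δ > 0`), forces `w` to have AT MOST ONE ZERO in `D`.
  In the box's waist units all `B_k` are `Γ`-free: `B_k = O(γ_k/d_k²)` for the partners, `B_j = O(Rb² + 1/log Γ)` for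
  the filament itself (memo `SIGMA-SCALING-21220.md` §4–§7): clause 11 can only fail in the `Γ`-independent zone where
  the partner strain is not small, and there rung 0 (p569595) controls `w`.

HONEST FRAMING.  Bookkeeping for the rung ladder of a HYPOTHETICAL filament box (with the extra `C^{2,1}` modulus `H`);
nothing here is a claim about Navier–Stokes regularity or blow-up.
-/

set_option linter.dupNamespace false

noncomputable section

namespace Summit.NavierStokesRegularity.NavierStokesRegularity.Theorems

open Set Function Filter MeasureTheory Real
open Literature.Analysis.FluidPDE
open scoped InnerProductSpace Topology

namespace SelectionBoxRJRung

/-- **Quantitative zone lemma for clause 11.**  See the module docstring. [folklore] -/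
theorem box_zone_zero_unique_quantitative {N : ℕ} {e c₀ α c c' H κ₀ δ θ : ℝ} {C Dk Ak : Fin N → ℝ}
    {coef : Fin N → ℝ} {u₀ : Fin N → ℝ → ℝ} {Xs : Fin N → ℝ → EuclideanSpace ℝ (Fin 3)}
    {a₀ : EuclideanSpace ℝ (Fin 3)} (j : Fin N)
    (he : e ≠ 0) (hc₀ : 0 < c₀) (hXs : ∀ k, ContDiff ℝ 1 (Xs k))
    (hdXs : ∀ k u, ‖deriv (Xs k) u‖ ≤ 1) (hgrow : ∀ k u, c₀ * |u| - C k ≤ ‖Xs k u‖)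
    (hXj : ContDiff ℝ 2 (Xs j)) (hunit : ∀ τ, ‖deriv (Xs j) τ‖ = 1) (hκ₀ : ∀ u, ‖deriv (deriv (Xs j)) u‖ ≤ κ₀)
    (hH : 0 ≤ H) (hLip : ∀ u v, ‖deriv (deriv (Xs j)) u - deriv (deriv (Xs j)) v‖ ≤ H * |u - v|)
    (ha₀ : ‖a₀‖ ≤ 1) (hθ : ∀ u, ‖deriv (Xs j) u - a₀‖ ≤ θ) (hδ : 0 < δ)
    {w : ℝ → ℝ} (hw : Differentiable ℝ w) {S : Set ℝ} (hS : IsOpen S)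
    (htan : ∀ τ ∈ S, (∑ k, coef k • ∫ u : ℝ, ((‖Xs j τ - Xs k u‖ ^ 2 + e ^ 2) ^ (3 / 2 : ℝ))⁻¹ •
        cross (deriv (Xs k) u) (Xs j τ - Xs k u)) +
        ((1 / 2 : ℝ) • Xs j τ - α • cross (EuclideanSpace.single 2 1) (Xs j τ)) = w τ • deriv (Xs j) τ)
    {D : Set ℝ} (hD : Convex ℝ D) (hDS : D ⊆ S)
    (hc : 0 < c) (hchord : ∀ τ ∈ D, ∀ u, c * |u - τ| ≤ ‖Xs j u - Xs j τ‖)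
    (hc' : 0 < c') (hDk : ∀ k, k ≠ j → 0 < Dk k) (hAk : ∀ k, k ≠ j → 0 ≤ Ak k)
    (hfar : ∀ k, k ≠ j → ∀ τ ∈ D, ∀ u, Dk k ≤ ‖Xs j τ - Xs k u‖)
    (hesc : ∀ k, k ≠ j → ∀ τ ∈ D, ∀ u, c' * |u - u₀ k τ| - Ak k ≤ ‖Xs j τ - Xs k u‖)
    (hsmall : ∑ k, |coef k| * (if k = j then 6 * θ / (c ^ 4 * δ ^ 2) + 2 * δ * (3 / c ^ 4 * (3 / 2 * κ₀ * H + H ^ 2 * δ))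
        else 8 * Real.pi * (Dk k + Ak k) / (c' * Dk k ^ 3)) < 1 / 2)
    {a b : ℝ} (ha : a ∈ D) (hb : b ∈ D) (hwa : w a = 0) (hwb : w b = 0) : a = b := by
  refine box_zone_zero_unique he hc₀ hXs hdXs hgrow hXj hunit hw hS htan hD hDS (fun τ hτ => ?_) ha hb hwa hwb
  -- termwise bounds on the axial strains
  set B : Fin N → ℝ := fun k => if k = j then 6 * θ / (c ^ 4 * δ ^ 2) + 2 * δ * (3 / c ^ 4 * (3 / 2 * κ₀ * H + H ^ 2 * δ))
      else 8 * Real.pi * (Dk k + Ak k) / (c' * Dk k ^ 3) with hB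
  set sk : Fin N → ℝ := fun k => ⟪fderiv ℝ (fun y : EuclideanSpace ℝ (Fin 3) => ∫ u : ℝ,
        ((‖y - Xs k u‖ ^ 2 + e ^ 2) ^ (3 / 2 : ℝ))⁻¹ • cross (deriv (Xs k) u) (y - Xs k u)) (Xs j τ) (deriv (Xs j) τ),
        deriv (Xs j) τ⟫_ℝ with hsk
  have hbound : ∀ k, |sk k| ≤ B k := by
    intro k
    by_cases hkj : k = j
    · subst hkj
      simp only [hB, hsk, if_true]
      rw [real_inner_comm]
      exact self_axialStrain_le he hc₀ (hgrow k) hXj hunit hκ₀ hH hLip hc (hchord τ hτ) hδ ha₀ hθ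
    · simp only [hB, hsk, hkj, if_false]
      rw [real_inner_comm]
      exact biotSavart_axialStrain_le (u₀ := u₀ k τ) he hc₀ (hXs k) (hdXs k) (hgrow k) (hunit τ) hc' (hDk k hkj)
        (hAk k hkj) (hfar k hkj τ hτ) (hesc k hkj τ hτ)
  -- `Σ coef_k s_k ≥ −Σ |coef_k| B_k > −½`
  have hsum : -(∑ k, |coef k| * B k) ≤ ∑ k, coef k * sk k := by
    rw [← Finset.sum_neg_distrib]
    refine Finset.sum_le_sum fun k _ => ?_
    have h1 : |coef k * sk k| ≤ |coef k| * B k := by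
      rw [abs_mul]; exact mul_le_mul_of_nonneg_left (hbound k) (abs_nonneg _)
    linarith [neg_abs_le (coef k * sk k)]
  have hs' : ∑ k, |coef k| * B k < 1 / 2 := by simpa only [hB] using hsmall
  show -(1 / 2 : ℝ) < ∑ k, coef k * sk k
  linarith

end SelectionBoxRJRung

end Summit.NavierStokesRegularity.NavierStokesRegularity.Theorems
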